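import Mathlib
import Summits.Ventures.PercRepro2.HCov
import Summits.Ventures.PercRepro2.BHKAvoid
import Summits.Ventures.PercRepro2.CutVertexDefs
import Summits.Ventures.PercRepro2.A3RootEdgeMain
import Summits.Ventures.PercRepro2.CPolarSubPlus
import Summits.Ventures.PercRepro2.HCovPlusQuartic
import Summits.Ventures.PercRepro2.QuarticRootCross
import Summits.Ventures.PercRepro2.QuarticRootCrossOL
import Summits.Ventures.PercRepro2.QuarticRootFree

/-!
# THE ROOT-EDGE FACE OF THE QUARTIC IS FREE WHEN THE ROOT `a₁` IS A CUT VERTEX BETWEEN `a₃` AND `a₂`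
(blind cell PercRepro2, p5 g19; `proofs/P5-OEDGE.md` §25)

The «first case» of the root-edge face of record (§24 addendum 4: `T₀ = P(T) = 0`, i.e. `a₁` a cut
vertex separating `a₃` from `a₂`, where the face was expected to read `Q₁·Gc₀ ≥ 2·c⁻·δ_bH`) is
VACUOUS: on such an instance the `oH` deficit `δ_oH = P(PD, oH)·P(T′) − D·P(T′, oH)` is ZERO, so the
cross term `c = D₀·P₀(PD, o ↔ a₃) + δ'_oL − δ_oH` is nonnegative, and `covU₀ ≥ 0` as well — the face is
free by `QuarticRootFree`. In the vocabulary of `CutVertexDefs` (`CutV.IsCut ends a₁ VA VB EA EB`,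
`a₃ ∈ VA`, `a₂ ∈ VB`, `o ∈ VA ∪ VB`):

* `T_eq_empty`: `T = {a₁ ↮ a₂, a₃ ∈ C₂} = ∅` (across the cut `a₃ ↔ a₂` forces `a₁ ↔ a₂`), so `P(T) = 0`
  (`prob_T_eq_zero_of_cut`);
* `PD_eq_side`, `T'_eq_side`: `PD = {a₁ ↮ a₃ in A} × Q_B`, `T′ = {a₁ ↔ a₃ in A} × Q_B` with
  `Q_B = {a₂ ↮ a₁ in B}` — the product law `CutV.prob_sideEvent_inter_eq_mul` factorises every mass;
* **`oH_deficit_eq_zero_of_cut`**: `P(PD, oH)·P(T′) = D·P(T′, oH)` — for `o ∈ VB` the `o`-events are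
  `B`-side and the `a₃`-events `A`-side (independent); for `o ∈ VA`, `Q ∩ {o ∈ C₂} = ∅`;
* **`covU_nonneg_of_cut`**: `0 ≤ covU = P(Q, o ∈ U)·D − Q·D_o` — zero for `o ∈ VB` (product law),
  `Q_B²·[P_A(o ↔ a₁)·P_A(a₃ ↮ a₁) − P_A(o ↔ a₁, a₃ ↮ a₁)] ≥ 0` for `o ∈ VA` (Harris on the `A`-side);
* **`covUm_nonneg_of_cut`**: `0 ≤ c` at the root edge (`QuarticRootCrossOL.covUm_root_ge` with the deficit
  zero); hence **`HCovPlus_of_update_zero_root_of_cut`**: (HCOV) ∧ (HCOV⁺) at the closed pin give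
  (HCOV⁺) at `p`, and **`HCov_and_HCovPlus_of_update_zero_root_of_cut`** adds the cubic's
  `A3RootEdgeMain.HCov_of_update_zero`.

So the open content of the root-edge face (`(F6′) ∧ (F4′)`, census-true) lies entirely on the
instances with `P(T) > 0`; the `T₀ = 0` case carries no information about the mechanism. Exact check
of the three claims on 60 + 60 random cut-vertex instances (`mining/p5/g19/probe/cutprobe.py`,
`t0probe.py`): `δ_oH = 0`, `covU₀ ≥ 0`, `c ≥ 0` on every one.
-/

namespace Summit.Ventures.PercRepro2

open UnionCluster CovForm CovForm.EdgeLine CovForm.RootEdge CPolarSubPlus HCovPlusQuartic CutV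

namespace QuarticRootCross

/-! ## The events of the `(o, a₁, a₂, a₃)` instance across a cut vertex at `a₁` -/
section CutEvents

variable {V : Type*} {E : Type*}
variable {ends : E → Sym2 V} {a₁ a₂ a₃ o : V} {VA VB : Set V} {EA EB : Set E}

/-- `{u ↔ v} = {v ↔ u}`. -/
lemma connEvent_comm' (ends : E → Sym2 V) (u v : V) : connEvent ends u v = connEvent ends v u := by
  ext ω
  exact ⟨conn_symm, conn_symm⟩

/-- `sideEvent F (A ∩ B) = sideEvent F A ∩ sideEvent F B`. -/
lemma sideEvent_inter (F : Set E) [DecidablePred (· ∈ F)] (A B : Set (Config E)) :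
    sideEvent F (A ∩ B) = sideEvent F A ∩ sideEvent F B := rfl

/-- `sideEvent F Aᶜ = (sideEvent F A)ᶜ`. -/
lemma sideEvent_compl (F : Set E) [DecidablePred (· ∈ F)] (A : Set (Config E)) :
    sideEvent F Aᶜ = (sideEvent F A)ᶜ := rfl

/-- `restrict F` is monotone in the configuration. -/
lemma restrict_mono' (F : Set E) [DecidablePred (· ∈ F)] {ω ω' : Config E} (h : ω ≤ ω') :
    restrict F ω ≤ restrict F ω' := by
  intro e
  by_cases he : e ∈ F
  · rw [restrict_apply_of_mem he, restrict_apply_of_mem he]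
    exact h e
  · rw [restrict_apply_of_notMem he, restrict_apply_of_notMem he]

/-- A side event of an increasing event is increasing. -/
lemma isUpperSet_sideEvent (F : Set E) [DecidablePred (· ∈ F)] {A : Set (Config E)}
    (hA : IsUpperSet A) : IsUpperSet (sideEvent F A) :=
  fun _ _ hle hω => hA (restrict_mono' F hle) hω

/-- **`Q = {a₂ ↮ a₁}` is a `B`-side event** when `a₂ ∈ VB`. -/
lemma Q_eq_side [DecidablePred (· ∈ EB)] (h : IsCut ends a₁ VA VB EA EB) (ha₂ : a₂ ∈ VB) :
    avoidAll ends a₂ {a₁} = (sideEvent EB (connEvent ends a₂ a₁))ᶜ := by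
  ext ω
  simp only [mem_avoidAll, Finset.mem_singleton, forall_eq, Set.mem_compl_iff, mem_sideEvent,
    mem_connEvent]
  exact not_congr (conn_iff_restrict h.symm (Or.inl ha₂) (Or.inr rfl))

/-- **`T = {a₁ ↮ a₂, a₃ ∈ C₂} = ∅`** across the cut: `a₃ ↔ a₂` forces `a₁ ↔ a₂`. -/
lemma T_eq_empty [DecidablePred (· ∈ EA)] [DecidablePred (· ∈ EB)]
    (h : IsCut ends a₁ VA VB EA EB) (ha₃ : a₃ ∈ VA) (ha₂ : a₂ ∈ VB) :
    TEvent ends a₁ a₂ a₃ = ∅ := by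
  ext ω
  simp only [TEvent, Set.mem_inter_iff, Set.mem_compl_iff, mem_connEvent, Set.mem_empty_iff_false,
    iff_false, not_and]
  intro h1 h2
  have h3 := (conn_across_iff h ha₃ ha₂).mp (conn_symm h2)
  exact h1 (conn_symm (conn_mono (restrict_le EB ω) h3.2))

/-- **`T′ = {a₁ ↮ a₂, a₃ ∈ C₁}`** is the product of the `A`-side event `{a₁ ↔ a₃}` and `Q`. -/
lemma T'_eq_side [DecidablePred (· ∈ EA)] [DecidablePred (· ∈ EB)]
    (h : IsCut ends a₁ VA VB EA EB) (ha₃ : a₃ ∈ VA) (ha₂ : a₂ ∈ VB) :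
    TEvent ends a₂ a₁ a₃ =
      sideEvent EA (connEvent ends a₁ a₃) ∩ (sideEvent EB (connEvent ends a₂ a₁))ᶜ := by
  ext ω
  simp only [TEvent, Set.mem_inter_iff, Set.mem_compl_iff, mem_connEvent, mem_sideEvent]
  rw [conn_iff_restrict h (Or.inr rfl) (Or.inl ha₃), and_comm]
  constructor
  · rintro ⟨h13, h12⟩
    exact ⟨h13, fun hc => h12 (conn_symm ((conn_iff_restrict h.symm (Or.inl ha₂) (Or.inr rfl)).mpr hc))⟩
  · rintro ⟨h13, h21⟩
    exact ⟨h13, fun hc => h21 ((conn_iff_restrict h.symm (Or.inl ha₂) (Or.inr rfl)).mp (conn_symm hc))⟩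

/-- **`PD = {a₁ ↮ a₂, a₃ ∉ U}`** is the product of the `A`-side event `{a₁ ↮ a₃}` and `Q`: under `Q`,
`a₃ ↮ a₂` is automatic across the cut. -/
lemma PD_eq_side [DecidablePred (· ∈ EA)] [DecidablePred (· ∈ EB)]
    (h : IsCut ends a₁ VA VB EA EB) (ha₃ : a₃ ∈ VA) (ha₂ : a₂ ∈ VB) :
    PDEvent ends a₁ a₂ a₃ =
      (sideEvent EA (connEvent ends a₁ a₃))ᶜ ∩ (sideEvent EB (connEvent ends a₂ a₁))ᶜ := by
  ext ω
  simp only [PDEvent, Dtilde, mem_inU, Set.mem_inter_iff, Set.mem_compl_iff, mem_connEvent,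
    mem_sideEvent, not_or]
  constructor
  · rintro ⟨h12, h31, -⟩
    exact ⟨fun hc => h31 (conn_symm ((conn_iff_restrict h (Or.inr rfl) (Or.inl ha₃)).mpr hc)),
      fun hc => h12 (conn_symm ((conn_iff_restrict h.symm (Or.inl ha₂) (Or.inr rfl)).mpr hc))⟩
  · rintro ⟨h13, h21⟩
    refine ⟨fun hc => h21 ((conn_iff_restrict h.symm (Or.inl ha₂) (Or.inr rfl)).mp (conn_symm hc)),
      fun hc => h13 ((conn_iff_restrict h (Or.inr rfl) (Or.inl ha₃)).mp (conn_symm hc)), fun hc => ?_⟩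
    have h3 := (conn_across_iff h ha₃ ha₂).mp hc
    exact h21 (conn_symm h3.2)

/-- For `o ∈ VB`, `{o ∈ C₂}` is a `B`-side event. -/
lemma connEvent_a2_o_eq_side [DecidablePred (· ∈ EB)] (h : IsCut ends a₁ VA VB EA EB)
    (ha₂ : a₂ ∈ VB) (ho : o ∈ VB) :
    connEvent ends a₂ o = sideEvent EB (connEvent ends a₂ o) :=
  connEvent_eq_sideEvent h.symm (Or.inl ha₂) (Or.inl ho)

/-- For `o ∈ VB`, `{o ∈ C₁}` is a `B`-side event. -/
lemma connEvent_a1_o_eq_side_B [DecidablePred (· ∈ EB)] (h : IsCut ends a₁ VA VB EA EB)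
    (ho : o ∈ VB) : connEvent ends a₁ o = sideEvent EB (connEvent ends a₁ o) :=
  connEvent_eq_sideEvent h.symm (Or.inr rfl) (Or.inl ho)

/-- For `o ∈ VA`, `{o ∈ C₁}` is an `A`-side event. -/
lemma connEvent_a1_o_eq_side_A [DecidablePred (· ∈ EA)] (h : IsCut ends a₁ VA VB EA EB)
    (ho : o ∈ VA) : connEvent ends a₁ o = sideEvent EA (connEvent ends a₁ o) :=
  connEvent_eq_sideEvent h (Or.inr rfl) (Or.inl ho)

/-- For `o ∈ VA`, `Q ∩ {o ∈ C₂} = ∅`: `o ↔ a₂` across the cut forces `a₁ ↔ a₂`. -/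
lemma Q_inter_oH_eq_empty [DecidablePred (· ∈ EA)] [DecidablePred (· ∈ EB)]
    (h : IsCut ends a₁ VA VB EA EB) (ha₂ : a₂ ∈ VB) (ho : o ∈ VA) :
    avoidAll ends a₂ {a₁} ∩ connEvent ends a₂ o = ∅ := by
  ext ω
  simp only [Set.mem_inter_iff, mem_avoidAll, Finset.mem_singleton, forall_eq, mem_connEvent,
    Set.mem_empty_iff_false, iff_false, not_and]
  intro h1 h2
  have h3 := (conn_across_iff h ho ha₂).mp (conn_symm h2)
  exact h1 (conn_symm (conn_mono (restrict_le EB ω) h3.2))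

/-- For `o ∈ VA`, `PD ∩ {o ∈ C₂} = ∅`. -/
lemma PD_inter_oH_eq_empty [DecidablePred (· ∈ EA)] [DecidablePred (· ∈ EB)]
    (h : IsCut ends a₁ VA VB EA EB) (ha₂ : a₂ ∈ VB) (ho : o ∈ VA) :
    PDEvent ends a₁ a₂ a₃ ∩ connEvent ends a₂ o = ∅ := by
  ext ω
  simp only [PDEvent, Set.mem_inter_iff, Set.mem_compl_iff, mem_connEvent, Set.mem_empty_iff_false,
    iff_false, not_and]
  intro h12 h2
  have h3 := (conn_across_iff h ho ha₂).mp (conn_symm h2)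
  exact h12.1 (conn_mono (restrict_le EB ω) h3.2)

/-- For `o ∈ VA`, `T′ ∩ {o ∈ C₂} = ∅`. -/
lemma T'_inter_oH_eq_empty [DecidablePred (· ∈ EA)] [DecidablePred (· ∈ EB)]
    (h : IsCut ends a₁ VA VB EA EB) (ha₂ : a₂ ∈ VB) (ho : o ∈ VA) :
    TEvent ends a₂ a₁ a₃ ∩ connEvent ends a₂ o = ∅ := by
  ext ω
  simp only [TEvent, Set.mem_inter_iff, Set.mem_compl_iff, mem_connEvent, Set.mem_empty_iff_false,
    iff_false, not_and]
  intro h12 h2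
  have h3 := (conn_across_iff h ho ha₂).mp (conn_symm h2)
  exact h12.1 (conn_mono (restrict_le EB ω) h3.2)

/-- For `o ∈ VB`: `Q ∩ {o ∈ C₂}` is the `B`-side event `{a₂ ↮ a₁, a₂ ↔ o}`. -/
lemma Q_inter_oH_eq_side [DecidablePred (· ∈ EB)] (h : IsCut ends a₁ VA VB EA EB)
    (ha₂ : a₂ ∈ VB) (ho : o ∈ VB) :
    avoidAll ends a₂ {a₁} ∩ connEvent ends a₂ o =
      sideEvent EB ((connEvent ends a₂ a₁)ᶜ ∩ connEvent ends a₂ o) := by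
  rw [Q_eq_side h ha₂, sideEvent_inter, sideEvent_compl, ← connEvent_a2_o_eq_side h ha₂ ho]

/-- For `o ∈ VB`: `Q ∩ {o ∈ C₁}` is the `B`-side event `{a₂ ↮ a₁, a₁ ↔ o}`. -/
lemma Q_inter_oL_eq_side_B [DecidablePred (· ∈ EB)] (h : IsCut ends a₁ VA VB EA EB)
    (ha₂ : a₂ ∈ VB) (ho : o ∈ VB) :
    avoidAll ends a₂ {a₁} ∩ connEvent ends a₁ o =
      sideEvent EB ((connEvent ends a₂ a₁)ᶜ ∩ connEvent ends a₁ o) := by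
  rw [Q_eq_side h ha₂, sideEvent_inter, sideEvent_compl, ← connEvent_a1_o_eq_side_B h ho]

/-- For `o ∈ VB`: `PD ∩ {o ∈ C₂} = {a₁ ↮ a₃}_A × {a₂ ↮ a₁, a₂ ↔ o}_B`. -/
lemma PD_inter_oH_eq_side [DecidablePred (· ∈ EA)] [DecidablePred (· ∈ EB)]
    (h : IsCut ends a₁ VA VB EA EB) (ha₃ : a₃ ∈ VA) (ha₂ : a₂ ∈ VB) (ho : o ∈ VB) :
    PDEvent ends a₁ a₂ a₃ ∩ connEvent ends a₂ o =
      (sideEvent EA (connEvent ends a₁ a₃))ᶜ ∩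
        sideEvent EB ((connEvent ends a₂ a₁)ᶜ ∩ connEvent ends a₂ o) := by
  rw [PD_eq_side h ha₃ ha₂, Set.inter_assoc]
  congr 1
  rw [sideEvent_inter, sideEvent_compl, ← connEvent_a2_o_eq_side h ha₂ ho]

/-- For `o ∈ VB`: `PD ∩ {o ∈ C₁} = {a₁ ↮ a₃}_A × {a₂ ↮ a₁, a₁ ↔ o}_B`. -/
lemma PD_inter_oL_eq_side_B [DecidablePred (· ∈ EA)] [DecidablePred (· ∈ EB)]
    (h : IsCut ends a₁ VA VB EA EB) (ha₃ : a₃ ∈ VA) (ha₂ : a₂ ∈ VB) (ho : o ∈ VB) :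
    PDEvent ends a₁ a₂ a₃ ∩ connEvent ends a₁ o =
      (sideEvent EA (connEvent ends a₁ a₃))ᶜ ∩
        sideEvent EB ((connEvent ends a₂ a₁)ᶜ ∩ connEvent ends a₁ o) := by
  rw [PD_eq_side h ha₃ ha₂, Set.inter_assoc]
  congr 1
  rw [sideEvent_inter, sideEvent_compl, ← connEvent_a1_o_eq_side_B h ho]

/-- For `o ∈ VB`: `T′ ∩ {o ∈ C₂} = {a₁ ↔ a₃}_A × {a₂ ↮ a₁, a₂ ↔ o}_B`. -/
lemma T'_inter_oH_eq_side [DecidablePred (· ∈ EA)] [DecidablePred (· ∈ EB)]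
    (h : IsCut ends a₁ VA VB EA EB) (ha₃ : a₃ ∈ VA) (ha₂ : a₂ ∈ VB) (ho : o ∈ VB) :
    TEvent ends a₂ a₁ a₃ ∩ connEvent ends a₂ o =
      sideEvent EA (connEvent ends a₁ a₃) ∩
        sideEvent EB ((connEvent ends a₂ a₁)ᶜ ∩ connEvent ends a₂ o) := by
  rw [T'_eq_side h ha₃ ha₂, Set.inter_assoc]
  congr 1
  rw [sideEvent_inter, sideEvent_compl, ← connEvent_a2_o_eq_side h ha₂ ho]

/-- For `o ∈ VA`: `Q ∩ {o ∈ C₁} = {a₁ ↔ o}_A × Q_B`. -/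
lemma Q_inter_oL_eq_side_A [DecidablePred (· ∈ EA)] [DecidablePred (· ∈ EB)]
    (h : IsCut ends a₁ VA VB EA EB) (ha₂ : a₂ ∈ VB) (ho : o ∈ VA) :
    avoidAll ends a₂ {a₁} ∩ connEvent ends a₁ o =
      sideEvent EA (connEvent ends a₁ o) ∩ (sideEvent EB (connEvent ends a₂ a₁))ᶜ := by
  conv_lhs => rw [Q_eq_side h ha₂, connEvent_a1_o_eq_side_A h ho, Set.inter_comm]

/-- For `o ∈ VA`: `PD ∩ {o ∈ C₁} = {a₁ ↮ a₃, a₁ ↔ o}_A × Q_B`. -/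
lemma PD_inter_oL_eq_side_A [DecidablePred (· ∈ EA)] [DecidablePred (· ∈ EB)]
    (h : IsCut ends a₁ VA VB EA EB) (ha₃ : a₃ ∈ VA) (ha₂ : a₂ ∈ VB) (ho : o ∈ VA) :
    PDEvent ends a₁ a₂ a₃ ∩ connEvent ends a₁ o =
      ((sideEvent EA (connEvent ends a₁ a₃))ᶜ ∩ sideEvent EA (connEvent ends a₁ o)) ∩
        (sideEvent EB (connEvent ends a₂ a₁))ᶜ := by
  conv_lhs => rw [PD_eq_side h ha₃ ha₂, connEvent_a1_o_eq_side_A h ho, Set.inter_right_comm]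

end CutEvents

/-! ## The masses across the cut: the product law -/
section CutMasses

variable {V : Type*} {E : Type*} [Fintype E] [DecidableEq E]
  {R : Type*} [Field R] [LinearOrder R] [IsStrictOrderedRing R]
variable {ends : E → Sym2 V} {a₁ a₂ a₃ o : V} {VA VB : Set V} {EA EB : Set E}

omit [LinearOrder R] [IsStrictOrderedRing R] in
/-- The product law with the `A`-side event complemented. -/
lemma prob_sideA_compl_inter [DecidablePred (· ∈ EA)] [DecidablePred (· ∈ EB)] (q : E → R)
    (h : IsCut ends a₁ VA VB EA EB) (A B : Set (Config E)) :
    prob q ((sideEvent EA A)ᶜ ∩ sideEvent EB B) = prob q (sideEvent EA A)ᶜ * prob q (sideEvent EB B) :=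
  prob_sideEvent_inter_eq_mul q h Aᶜ B

omit [LinearOrder R] [IsStrictOrderedRing R] in
/-- The product law with the `B`-side event complemented. -/
lemma prob_side_inter_complB [DecidablePred (· ∈ EA)] [DecidablePred (· ∈ EB)] (q : E → R)
    (h : IsCut ends a₁ VA VB EA EB) (A B : Set (Config E)) :
    prob q (sideEvent EA A ∩ (sideEvent EB B)ᶜ) = prob q (sideEvent EA A) * prob q (sideEvent EB B)ᶜ :=
  prob_sideEvent_inter_eq_mul q h A Bᶜ

omit [LinearOrder R] [IsStrictOrderedRing R] in
/-- The product law with both side events complemented. -/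
lemma prob_sideA_compl_inter_complB [DecidablePred (· ∈ EA)] [DecidablePred (· ∈ EB)] (q : E → R)
    (h : IsCut ends a₁ VA VB EA EB) (A B : Set (Config E)) :
    prob q ((sideEvent EA A)ᶜ ∩ (sideEvent EB B)ᶜ) =
      prob q (sideEvent EA A)ᶜ * prob q (sideEvent EB B)ᶜ :=
  prob_sideEvent_inter_eq_mul q h Aᶜ Bᶜ

omit [LinearOrder R] [IsStrictOrderedRing R] in
/-- The product law for an `A`-side event of the form `{a₁ ↮ a₃, a₁ ↔ o}` against a complemented
`B`-side event. -/
lemma prob_sideA_compl_inter_side_inter_complB [DecidablePred (· ∈ EA)] [DecidablePred (· ∈ EB)]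
    (q : E → R) (h : IsCut ends a₁ VA VB EA EB) (A A' B : Set (Config E)) :
    prob q (((sideEvent EA A)ᶜ ∩ sideEvent EA A') ∩ (sideEvent EB B)ᶜ) =
      prob q ((sideEvent EA A)ᶜ ∩ sideEvent EA A') * prob q (sideEvent EB B)ᶜ :=
  prob_sideEvent_inter_eq_mul q h (Aᶜ ∩ A') Bᶜ

omit [LinearOrder R] [IsStrictOrderedRing R] in
/-- `P(T) = 0` across the cut. -/
theorem prob_T_eq_zero_of_cut (q : E → R) [DecidablePred (· ∈ EA)] [DecidablePred (· ∈ EB)]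
    (h : IsCut ends a₁ VA VB EA EB) (ha₃ : a₃ ∈ VA) (ha₂ : a₂ ∈ VB) :
    prob q (TEvent ends a₁ a₂ a₃) = 0 := by
  rw [T_eq_empty h ha₃ ha₂, prob_empty]

omit [LinearOrder R] [IsStrictOrderedRing R] in
/-- **The `oH` deficit vanishes across the cut**: `P(PD, oH)·P(T′) = D·P(T′, oH)`. -/
theorem oH_deficit_eq_zero_of_cut (q : E → R) [DecidablePred (· ∈ EA)] [DecidablePred (· ∈ EB)]
    (h : IsCut ends a₁ VA VB EA EB) (ha₃ : a₃ ∈ VA) (ha₂ : a₂ ∈ VB) (ho : o ∈ VA ∪ VB) :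
    prob q (PDEvent ends a₁ a₂ a₃ ∩ connEvent ends a₂ o) * prob q (TEvent ends a₂ a₁ a₃) =
      prob q (PDEvent ends a₁ a₂ a₃) * prob q (TEvent ends a₂ a₁ a₃ ∩ connEvent ends a₂ o) := by
  rcases ho with hoA | hoB
  · rw [PD_inter_oH_eq_empty h ha₂ hoA, T'_inter_oH_eq_empty h ha₂ hoA, prob_empty, zero_mul,
      mul_zero]
  · rw [PD_inter_oH_eq_side h ha₃ ha₂ hoB, T'_inter_oH_eq_side h ha₃ ha₂ hoB, PD_eq_side h ha₃ ha₂,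
      T'_eq_side h ha₃ ha₂, prob_sideA_compl_inter q h, prob_sideEvent_inter_eq_mul q h,
      prob_sideA_compl_inter_complB q h, prob_side_inter_complB q h]
    ring

/-- **`0 ≤ covU` across the cut**: `P(Q, o ∈ U)·D − Q·D_o` is zero for `o ∈ VB` (the `o`-events are
`B`-side) and `Q_B²·[P_A(o ↔ a₁)·P_A(a₃ ↮ a₁) − P_A(o ↔ a₁, a₃ ↮ a₁)] ≥ 0` for `o ∈ VA` (Harris). -/
theorem covU_nonneg_of_cut (q : E → R) (hq : IsProbVec q) [DecidablePred (· ∈ EA)]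
    [DecidablePred (· ∈ EB)] (h : IsCut ends a₁ VA VB EA EB) (ha₃ : a₃ ∈ VA) (ha₂ : a₂ ∈ VB)
    (ho : o ∈ VA ∪ VB) : 0 ≤ covU q ends o a₁ a₂ a₃ := by
  unfold covU Do
  rcases ho with hoA | hoB
  · -- `o ∈ VA`
    rw [Q_inter_oH_eq_empty h ha₂ hoA, PD_inter_oH_eq_empty h ha₂ hoA, prob_empty,
      Q_inter_oL_eq_side_A h ha₂ hoA, PD_inter_oL_eq_side_A h ha₃ ha₂ hoA, PD_eq_side h ha₃ ha₂,
      Q_eq_side h ha₂, prob_side_inter_complB q h, prob_sideA_compl_inter_complB q h,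
      prob_sideA_compl_inter_side_inter_complB q h]
    -- Harris on the `A`-side: `{a₁ ↮ a₃}` decreasing, `{a₁ ↔ o}` increasing
    have hH := prob_inter_le_prob_mul_prob_of_isLowerSet hq
      (isUpperSet_sideEvent EA (isUpperSet_connEvent ends a₁ a₃)).compl
      (isUpperSet_sideEvent EA (isUpperSet_connEvent ends a₁ o))
    have hy := prob_nonneg hq (sideEvent EB (connEvent ends a₂ a₁))ᶜ
    have key : 0 ≤ prob q (sideEvent EB (connEvent ends a₂ a₁))ᶜ *
        prob q (sideEvent EB (connEvent ends a₂ a₁))ᶜ *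
        (prob q (sideEvent EA (connEvent ends a₁ a₃))ᶜ * prob q (sideEvent EA (connEvent ends a₁ o)) -
          prob q ((sideEvent EA (connEvent ends a₁ a₃))ᶜ ∩ sideEvent EA (connEvent ends a₁ o))) :=
      mul_nonneg (mul_nonneg hy hy) (sub_nonneg.2 hH)
    linarith [key]
  · -- `o ∈ VB`
    rw [Q_inter_oH_eq_side h ha₂ hoB, Q_inter_oL_eq_side_B h ha₂ hoB, PD_inter_oH_eq_side h ha₃ ha₂ hoB,
      PD_inter_oL_eq_side_B h ha₃ ha₂ hoB, PD_eq_side h ha₃ ha₂, Q_eq_side h ha₂,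
      prob_sideA_compl_inter q h, prob_sideA_compl_inter q h, prob_sideA_compl_inter_complB q h]
    have key : (prob q (sideEvent EB ((connEvent ends a₂ a₁)ᶜ ∩ connEvent ends a₁ o)) +
        prob q (sideEvent EB ((connEvent ends a₂ a₁)ᶜ ∩ connEvent ends a₂ o))) *
        (prob q (sideEvent EA (connEvent ends a₁ a₃))ᶜ * prob q (sideEvent EB (connEvent ends a₂ a₁))ᶜ) -
        prob q (sideEvent EB (connEvent ends a₂ a₁))ᶜ *
        (prob q (sideEvent EA (connEvent ends a₁ a₃))ᶜ *
            prob q (sideEvent EB ((connEvent ends a₂ a₁)ᶜ ∩ connEvent ends a₁ o)) +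
          prob q (sideEvent EA (connEvent ends a₁ a₃))ᶜ *
            prob q (sideEvent EB ((connEvent ends a₂ a₁)ᶜ ∩ connEvent ends a₂ o))) = 0 := by ring
    linarith [key]

end CutMasses

/-! ## The root-edge face of the quartic is free across the cut -/
section CutFace

variable {V : Type*} {E : Type*} [Fintype V] [DecidableEq V] [Fintype E] [DecidableEq E]
  {R : Type*} [Field R] [LinearOrder R] [IsStrictOrderedRing R]
variable {ends : E → Sym2 V} {e : E} {a₁ a₂ a₃ o : V} {VA VB : Set V} {EA EB : Set E}

/-- **`0 ≤ c` at a root edge `{a₁, a₃}` when `a₁` cuts `a₃` from `a₂`**: the cross term is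
`D₀·P₀(PD, o ↔ a₃) + δ'_oL ≥ 0` because the `oH` deficit vanishes. -/
theorem covUm_nonneg_of_cut (p : E → R) (hp : IsProbVec p) (hends : ends e = s(a₁, a₃))
    (h : IsCut ends a₁ VA VB EA EB) (ha₃ : a₃ ∈ VA) (ha₂ : a₂ ∈ VB) (ho : o ∈ VA ∪ VB) :
    0 ≤ covUm p ends o a₁ a₂ a₃ e := by
  classical
  have hp₀ : IsProbVec (Function.update p e 0) := hp.update e le_rfl zero_le_one
  have h1 := covUm_root_ge p hp hends o a₂
  have h2 := oH_deficit_eq_zero_of_cut (Function.update p e 0) h ha₃ ha₂ ho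
  have h3 := mul_nonneg (prob_nonneg hp₀ (PDEvent ends a₁ a₂ a₃))
    (prob_nonneg hp₀ (PDEvent ends a₁ a₂ a₃ ∩ connEvent ends a₃ o))
  rw [h2] at h1
  linarith [h1, h3]

/-- **(HCOV⁺) across a root edge `{a₁, a₃}` whose root cuts `a₃` from `a₂`** follows from (HCOV) and
(HCOV⁺) at the closed pin: both cross quantities are nonnegative, so `QuarticRootFree` applies. -/
theorem HCovPlus_of_update_zero_root_of_cut (p : E → R) (hp : IsProbVec p)
    (hends : ends e = s(a₁, a₃)) (b : V) (h : IsCut ends a₁ VA VB EA EB) (ha₃ : a₃ ∈ VA)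
    (ha₂ : a₂ ∈ VB) (ho : o ∈ VA ∪ VB)
    (h₀ : HCov (Function.update p e 0) ends o a₁ a₂ a₃ b)
    (h₀' : HCovPlus (Function.update p e 0) ends o a₁ a₂ a₃ b) :
    HCovPlus p ends o a₁ a₂ a₃ b := by
  classical
  have hp₀ : IsProbVec (Function.update p e 0) := hp.update e le_rfl zero_le_one
  exact HCovPlus_of_update_zero_root_of_nonneg p hp hends o a₂ b h₀ h₀'
    (covUm_nonneg_of_cut p hp hends h ha₃ ha₂ ho)
    (covU_nonneg_of_cut (Function.update p e 0) hp₀ h ha₃ ha₂ ho)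

/-- **Both (HCOV) and (HCOV⁺) across a cut root edge** from the closed pin — the joint induction of the
quartic road needs nothing from its hypothesis on this class. -/
theorem HCov_and_HCovPlus_of_update_zero_root_of_cut (p : E → R) (hp : IsProbVec p)
    (hends : ends e = s(a₁, a₃)) (b : V) (h : IsCut ends a₁ VA VB EA EB) (ha₃ : a₃ ∈ VA)
    (ha₂ : a₂ ∈ VB) (ho : o ∈ VA ∪ VB)
    (h₀ : HCov (Function.update p e 0) ends o a₁ a₂ a₃ b)
    (h₀' : HCovPlus (Function.update p e 0) ends o a₁ a₂ a₃ b) :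
    HCov p ends o a₁ a₂ a₃ b ∧ HCovPlus p ends o a₁ a₂ a₃ b :=
  ⟨HCov_of_update_zero p hp ends o a₁ a₂ a₃ b e hends h₀,
    HCovPlus_of_update_zero_root_of_cut p hp hends b h ha₃ ha₂ ho h₀ h₀'⟩

end CutFace

end QuarticRootCross

end Summit.Ventures.PercRepro2
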